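import Literature.AlgebraicGeometry.ModuliOfAbelianVarieties.SiegelAdelicMarkingTorusPresentation
import Literature.AlgebraicGeometry.ModuliOfAbelianVarieties.SiegelFamilyIsotropicKernelDescent
import Literature.AlgebraicGeometry.ModuliOfAbelianVarieties.SiegelPrincipalLevelArithmeticGroup
import Literature.Geometry.Kaehler.ComplexTorusAppellHumbertSymmetric
import Literature.Geometry.Kaehler.ComplexTorusNeronSeveriEndomorphisms
import Literature.Geometry.Kaehler.ComplexTorusPicardGroup
import Literature.NumberTheory.Transcendental.AbelianVarietyAnalyticLieGroup
import HarnessLib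

/-!
# The NS-level frame of a T1′ marking by `[J(Z), r]`, `r ∈ K_δ(1)`: a uniformisation with Appell–Humbert data of type `δ`

Layer `Literature/AlgebraicGeometry/ModuliOfAbelianVarieties`, namespace `Literature.AlgebraicGeometry.ModuliOfAbelianVarieties`.
THEOREMS ONLY (no definition, no named fact, no instance).  Cell `hodgecm-mathlib`, (U)-lane node U-aΘ, leaf L0 (socket
`UaTheta_L0_frameOfMarking` of the (U)-HEAD skeleton, text verbatim in `uaTheta_L0_frameOfMarking` below; kernel-green HOME
predecessor `B-plan/probes/UaTheta-L0-FrameOfMarking.v1.B-p15g8.lean`, B-p15 (g8)).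

Let `A₀` be a complex abelian variety with a T1′ marking `m : SiegelAdelicMarking ⟨J(Z), _⟩ r A₀` by the Shimura-set point
`[J(Z), r]` of type `δ` (`Z ∈ 𝔥_g`) at a PRINCIPAL representative `r ∈ K_δ(1)`.  THEN `A₀` carries a torus uniformisation
`φ : ℂ^g/Φ(ℤ^{2g}) → A₀(ℂ)` (an analytification compatible with the group laws), an Appell–Humbert datum `p = (H, χ)` on it whose
form `E = Im H` is a RIEMANN FORM of type `δ`, and an integer frame `T` of the lattice with `Tᵀ E T = E_δ` (the standard
alternating matrix of type `δ`) in which the marking's division-point reading is `m.r v = φ [T v]` for all `v ∈ ℚ^{2g}`.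

Proof: take the SIEGEL presentation `Φ_Z` of `X_Z = ℂ^g/(Z, Δ)ℤ^{2g}` with its Riemann form `E_Z` of type `δ`
(★ `isRiemannForm_siegelForm`, ★ `isPolarizationType_siegelForm`, ★ `latticeGram_siegelForm`; any semicharacter,
★ `IsNSForm.exists_isSemicharacter`), the frame `T = 1`, and `φ = m.toFun ∘ e` where `e : X_Z ≃ ℂ^g/Ψ_m(ℤ^{2g})` is the additive
biholomorphic base change by `γ_m⁻¹ ∈ GL_{2g}(ℤ)` (★ `ComplexTorus.exists_homeomorph_of_baseChange`,
★ `IsLatticeBasis.exists_int_of_mem_principalLevelSubgroup_one`; `ℂ`-linearity by ★ `siegelPeriodMap_jOfSiegel_mulVec` and the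
marking's field `Ψ_J`); then `m.r v = m.toFun [γ⁻¹ v] = φ [v]` (★ `SiegelAdelicMarking.r_def`, ★ `ComplexTorus.mapMatrix_proj`).  The
dimension `g = dim A₀` (★ `SiegelAdelicMarking.dim_eq`) is substituted, so no transport of the model space is needed.
HC_CM is proved only modulo the 7 printed citations until rung 0 closes; this file discharges none of them.

## References
* [Lange2023AbelianVarietiesComplex] H. Lange, *Abelian Varieties over the Complex Numbers* (2023), §1.1.2 (Prop. 1.1.8), §1.5.1,
  §3.1 (3.1), §7.1.2 (7.3).
* [LangeBirkenhake1992] H. Lange, Ch. Birkenhake, *Complex Abelian Varieties* (1992), §3.1 (type of a polarization), §8.1 Prop. 8.1.1.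
* [Milne2005ShimuraVarieties] J. S. Milne, *Introduction to Shimura varieties* (2005), §6 Thm. 6.11 p. 74.
-/

set_option autoImplicit false

noncomputable section

open CategoryTheory CategoryTheory.Limits AlgebraicGeometry Matrix Topology
open scoped Manifold ContDiff

namespace Literature.AlgebraicGeometry.ModuliOfAbelianVarieties

open Literature.AlgebraicGeometry.Motives (AbelianVariety AlgPoints CartierDivisor specOver ComplexPoints)
open Literature.Geometry.Kaehler (ComplexTorus)
open Literature.Geometry.Kaehler.ComplexTorus (AHData proj mapMatrix intGram)
open Literature.NumberTheory.Transcendental (IsAnalytification)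
open Literature.NumberTheory.Adeles
open Literature.NumberTheory.Automorphic (siegelUpperHalfSpace)
open SiegelModuli

/-- **The NS-level frame of a marking by `[J(Z), r]`, `r ∈ K_δ(1)`** (the cell's socket `UaTheta_L0_frameOfMarking`, text
verbatim): for `A₀` marked by `m : SiegelAdelicMarking ⟨J(Z), _⟩ r A₀` with `r` principal, there are a torus uniformisation
`φ : ℂ^g/Φ(ℤ^ι) → A₀(ℂ)` (an analytification, additive-to-multiplicative), an Appell–Humbert datum `p` whose form is a Riemann
form of type `δ`, and an integer frame `T` with `Tᵀ (Im H) T = E_δ` such that `m.r v = φ [T v]` for every `v ∈ ℚ^{2g}`.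
Witnesses: the SIEGEL presentation `Φ_Z` with its form `E_Z` (★ `isRiemannForm_siegelForm`, ★ `isPolarizationType_siegelForm`,
★ `latticeGram_siegelForm`; any semicharacter), `T = 1`, and `φ = m.toFun ∘ e` with `e : X_Z ≃ ℂ^g/Ψ_m(ℤ^{2g})` the additive
biholomorphic base change by `γ_m⁻¹ ∈ GL_{2g}(ℤ)` (★ `ComplexTorus.exists_homeomorph_of_baseChange`,
★ `IsLatticeBasis.exists_int_of_mem_principalLevelSubgroup_one`); the reading is ★ `r_def` + ★ `mapMatrix_proj`; `g = dim A₀`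
(★ `dim_eq`) is substituted first.
[cite: Lange2023AbelianVarietiesComplex, §1.5.1 and §3.1 (3.1), §1.1.2 (Prop. 1.1.8)] [cite: Milne2005ShimuraVarieties, §6 Thm. 6.11 p. 74] -/
theorem uaTheta_L0_frameOfMarking :
    ∀ {g : ℕ} {δ : Fin g → ℕ} (hδ : IsPolarizationType δ) (Z : siegelUpperHalfSpace g)
      {r : gspFinAdelic δ} (_hr : r ∈ principalLevelSubgroup δ 1) {A₀ : AbelianVariety ℂ}
      (m : SiegelAdelicMarking ⟨jOfSiegel δ Z, jOfSiegel_coe_mem_C0pm hδ.1 Z⟩ r A₀),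
      ∃ (ι : Type) (_ : Fintype ι) (_ : DecidableEq ι) (Φ : (ι → ℝ) ≃L[ℝ] (Fin A₀.dim → ℂ))
        (φ : ComplexTorus Φ → ComplexPoints A₀.X) (_hφ : IsAnalytification (Fin A₀.dim → ℂ) A₀.X A₀.dim φ)
        (_hadd : ∀ x y, φ (x + y) = φ x * φ y)
        (p : AHData Φ) (_hR : Literature.Geometry.Kaehler.ComplexTorus.IsRiemannForm Φ p.form)
        (_htype : ComplexTorus.IsPolarizationType Φ p.form δ)
        (T : Matrix ι (Fin g ⊕ Fin g) ℤ) (_hT : Tᵀ * intGram Φ p.form * T = typeForm δ),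
        ∀ v : Fin g ⊕ Fin g → ℚ, m.r v = φ (mapMatrix m.Ψ Φ T (proj m.Ψ fun i => ((v i : ℚ) : ℝ))) := by
  intro g δ hδ Z r hr A₀ m
  classical
  obtain hdim := m.dim_eq
  subst hdim
  have hδ0 : ∀ i, 0 < δ i := hδ.1
  have hZ : (Z : Matrix _ _ ℂ) ∈ siegelUpperHalfSpace A₀.dim := Z.2
  -- the Siegel presentation and its Riemann form of type `δ`
  let ΦZ : (Fin A₀.dim ⊕ Fin A₀.dim → ℝ) ≃L[ℝ] (Fin A₀.dim → ℂ) := siegelPeriodEquiv hδ0 hZ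
  have hRF : ComplexTorus.IsRiemannForm ΦZ (siegelForm hδ0 hZ) := isRiemannForm_siegelForm hδ0 hZ
  obtain ⟨χ, hχ⟩ := hRF.isNSForm.exists_isSemicharacter
  let p : AHData ΦZ := ⟨siegelForm hδ0 hZ, χ, hRF.isNSForm, hχ⟩
  have htype : ComplexTorus.IsPolarizationType ΦZ p.form δ := isPolarizationType_siegelForm hδ0 hZ hδ.2
  have hT : (1 : Matrix (Fin A₀.dim ⊕ Fin A₀.dim) (Fin A₀.dim ⊕ Fin A₀.dim) ℤ)ᵀ * intGram ΦZ p.form * 1 =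
      typeForm δ := by
    rw [Matrix.transpose_one, Matrix.one_mul, Matrix.mul_one]
    apply Matrix.map_injective (Int.cast_injective (α := ℝ))
    change (intGram ΦZ (siegelForm hδ0 hZ)).map (Int.cast : ℤ → ℝ) = _
    rw [ComplexTorus.map_intGram ΦZ hRF.isNSForm]
    exact latticeGram_siegelForm hδ0 hZ
  -- the base change `e : X_Z ≃ ℂ^g/Ψ(ℤ^{2g})` by `γ⁻¹ ∈ GL_{2g}(ℤ)` (as in ★ `exists_homeomorph_siegelTorus`, keeping the formula)
  obtain ⟨P, Q, hP, hQ, hPQ, hQP⟩ := IsLatticeBasis.exists_int_of_mem_principalLevelSubgroup_one hr m.γ_isLatticeBasis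
  set Gℝ : Matrix (Fin A₀.dim ⊕ Fin A₀.dim) (Fin A₀.dim ⊕ Fin A₀.dim) ℝ :=
    ((m.γ⁻¹ : GL (Fin A₀.dim ⊕ Fin A₀.dim) ℚ) : Matrix _ _ ℚ).map (algebraMap ℚ ℝ) with hGℝ
  set Gℝ' : Matrix (Fin A₀.dim ⊕ Fin A₀.dim) (Fin A₀.dim ⊕ Fin A₀.dim) ℝ :=
    ((m.γ : GL (Fin A₀.dim ⊕ Fin A₀.dim) ℚ) : Matrix _ _ ℚ).map (algebraMap ℚ ℝ) with hGℝ'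
  have hGG' : Gℝ * Gℝ' = 1 := by
    rw [hGℝ, hGℝ', ← Matrix.map_mul, ← Units.val_mul, inv_mul_cancel, Units.val_one, Matrix.map_one _ (map_zero _) (map_one _)]
  have hG'G : Gℝ' * Gℝ = 1 := by
    rw [hGℝ, hGℝ', ← Matrix.map_mul, ← Units.val_mul, mul_inv_cancel, Units.val_one, Matrix.map_one _ (map_zero _) (map_one _)]
  let L : (Fin A₀.dim ⊕ Fin A₀.dim → ℝ) ≃ₗ[ℝ] (Fin A₀.dim ⊕ Fin A₀.dim → ℝ) :=
    LinearEquiv.ofLinear (Matrix.toLin' Gℝ) (Matrix.toLin' Gℝ')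
      (by rw [← Matrix.toLin'_mul, hGG', Matrix.toLin'_one])
      (by rw [← Matrix.toLin'_mul, hG'G, Matrix.toLin'_one])
  have hL : ∀ y, L y = Gℝ *ᵥ y := fun y => Matrix.toLin'_apply _ _
  let Ψlin : (Fin A₀.dim → ℂ) ≃L[ℝ] (Fin A₀.dim → ℂ) :=
    ((ΦZ.symm.toLinearEquiv.trans L).trans m.Ψ.toLinearEquiv).toContinuousLinearEquiv
  have hΨlin : ∀ x, Ψlin (ΦZ x) = m.Ψ (Gℝ *ᵥ x) := fun x => by
    change m.Ψ (L (ΦZ.symm (ΦZ x))) = _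
    rw [ContinuousLinearEquiv.symm_apply_apply, hL]
  have hcastcomp : (Int.cast : ℤ → ℝ) = (algebraMap ℚ ℝ) ∘ (Int.cast : ℤ → ℚ) :=
    funext fun z => by simp only [Function.comp_apply, eq_ratCast, Rat.cast_intCast]
  have hPℝ : P.map (Int.cast : ℤ → ℝ) = Gℝ := by
    rw [hGℝ, ← hP, Matrix.map_map, hcastcomp]
  have hΨI : ∀ u, Ψlin (Complex.I • u) = Complex.I • Ψlin u := fun u => by
    obtain ⟨x, rfl⟩ := ΦZ.surjective u
    have hint : Complex.I • ΦZ x = ΦZ ((jOfSiegel δ (Z : Matrix _ _ ℂ)) *ᵥ x) := by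
      change Complex.I • siegelPeriodEquiv hδ0 hZ x = siegelPeriodEquiv hδ0 hZ _
      rw [siegelPeriodEquiv_apply, siegelPeriodEquiv_apply, siegelPeriodMap_jOfSiegel_mulVec hδ0 hZ]
    rw [hint, hΨlin, hΨlin]
    exact m.Ψ_J x
  obtain ⟨e, he, -, headd, hed, -⟩ :=
    Literature.Geometry.Kaehler.ComplexTorus.exists_homeomorph_of_baseChange ΦZ m.Ψ P Q hPQ hQP Ψlin hΨI fun x => by
      rw [hPℝ, hΨlin]
  -- the uniformisation `φ := m.toFun ∘ e`
  have hφ : IsAnalytification (Fin A₀.dim → ℂ) A₀.X A₀.dim (m.toFun ∘ e) :=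
    m.isAnalytification.comp_of_isHomeomorph e.isHomeomorph (hed.mdifferentiable (by simp)) rfl
  refine ⟨Fin A₀.dim ⊕ Fin A₀.dim, inferInstance, inferInstance, ΦZ, m.toFun ∘ e, hφ, fun x y => ?_, p, hRF, htype, 1,
    hT, fun v => ?_⟩
  · change m.toFun (e (x + y)) = m.toFun (e x) * m.toFun (e y)
    rw [headd, m.toFun_add]
  · -- the reading: `m.r v = toFun [γ⁻¹ v] = toFun (e [v]_Z) = φ (mapMatrix 1 [v])`
    change m.r v = m.toFun (e (mapMatrix m.Ψ ΦZ 1 (proj m.Ψ fun i => ((v i : ℚ) : ℝ))))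
    rw [ComplexTorus.mapMatrix_proj, Matrix.map_one _ Int.cast_zero Int.cast_one, Matrix.one_mulVec, he,
      ComplexTorus.mapMatrix_proj, hPℝ, m.r_def]
    congr 1
    congr 1
    funext i
    rw [hGℝ]
    have h := RingHom.map_mulVec (algebraMap ℚ ℝ)
      (((m.γ⁻¹ : GL (Fin A₀.dim ⊕ Fin A₀.dim) ℚ) : Matrix (Fin A₀.dim ⊕ Fin A₀.dim) (Fin A₀.dim ⊕ Fin A₀.dim) ℚ)) v i
    rw [eq_ratCast] at h
    refine h.trans ?_
    rfl

end Literature.AlgebraicGeometry.ModuliOfAbelianVarieties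

end
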